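import Mathlib
import HarnessLib
import HarnessLib.Audit
import Summits.HubbardSuperconductivity.Statement

/-!
Route: GSCertificate

CLOSED (superseded) 2026-08-15T12:56:19Z by planner-HubbardSuperconductivity-route-HubbardSuperconductivity-GSCertificate-0 — reason: superseded:route-HubbardSuperconductivity-FunctionFieldCertificate — superseded by route-HubbardSuperconductivity-FunctionFieldCertificate — note: route-repair (planner, 2026-08-15): SUPERSEDED by route-HubbardSuperconductivity-FunctionFieldCertificate (open, rev 2, typed, D-0019 shape). WHY: (1) GSCertificate's thesis X -- an L-independent FINITE-RANGE intensive SOS+KKT operator identity certifying L^-4 Delta_d^+Delta_d >= a > 0 -- is EMPTY a. The file is kept as the record of this route; refuted decls are indexed as negative knowledge (`ledger negatives`).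

# Route GSCertificate — HubbardSuperconductivity (planner-HubbardSuperconductivity-Survey-0,
2026-08-13; brief=widen)

## Thesis X (it suffices to show) — posits a NEW OBJECT (interface) + a CONSTRUCTION item
Interface `GSCertificate U δ r k a` (definition request filed, target
Summits/HubbardSuperconductivity/Theorems/
Certificate/): a finite family of translation-averaged polynomials in the torus CAR generators of
range ≤ r and
degree ≤ k with L-INDEPENDENT coefficients — SOS terms O_j, "variational" terms Q_m
(sector-preserving), a Hermitian
R, and sector terms T (in the ideal generated by N - N_L and S^z) — such that for all L ≥ L₀ the
operator identity
  L⁻⁴ Δ_d†Δ_d - a·1 = Σ_j O_j†O_j + Σ_m Q_m†[H_L, Q_m] + i[H_L, R] + T        (H_L = hubbardTorus 2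
L 1 U)
holds on Fock((ℤ/Lℤ)²). Soundness (elementary): in ANY (N_L, S^z=0)-sector ground state each RHS
term has expectation
≥ 0, = variational ≥ 0, = 0, = 0 respectively, so L⁻⁴⟨Δ_d†Δ_d⟩ ≥ a for every sector GS and every L ≥
L₀ (odd L too).
X := ∃ U ≠ 0, δ ∈ (0,1), r k, a > 0, Nonempty (GSCertificate U δ r k a).   Assembly X → S =
soundness lemma.
Lean: informal today (needs_definition GSCertificate; olean outage, see STATUS).

## Why this line (widen: convex optimisation / noncommutative sums of squares / SDP duality;
certified computation)
With the FULL operator algebra the constraints ω(Q†[H,Q]) ≥ 0 ∀Q pin ω to ground-state mixtures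
exactly, so a
certificate exists for each L iff S holds at that L — the entire content of X is LOCALITY +
L-UNIFORMITY of the
certificate, i.e. whether d-wave LRO is a finitely-certifiable consequence of local ground-state
constraints. This is
the relaxation behind the recent certified ground-state SDP hierarchies [WangEtAl2024,
FawziFawziScalet2024], and the
Kennedy–Lieb–Shastry proof of 2D XY ground-state order [KLS1988PRL] IS such a certificate in
disguise (infrared bound
from RP = the Q-terms at each k ≠ 0, sum rule = the identity), so the interface has at least one
non-trivial instance
in a neighbouring model. Certificates found numerically (SDP at fixed r,k with rational rounding)
become Lean proofs by
`norm_num`-style verification of a finite operator identity — the only route here whose success mode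
is mechanical.

## Ranked cruxes
2. CONSTRUCTION: some (U, δ, r, k, a > 0) admits a GSCertificate (numerical SDP search at r ≤ 3, k ≤
4 first, on the
   dual ShibaRP side as well). Informal; needs_definition GSCertificate.
3. Obstruction lemma (Lean-statable, provable now, calibrates the interface): ENERGY-ONLY
certificates are useless —
   if for all L and all unit ψ in szSector N_L 0: L⁻⁴Re⟨ψ,Δ_d†Δ_dψ⟩ ≥ a - b(Re⟨ψ,H_Lψ⟩/L² - e₀) with
a > 0, b ≥ 0,
   then a ≤ b·(liminf_L e_GS(L) - e₀) (proof: U(1) phase twist e^{iΣθ_x n_x}, θ = 2πj x₁/L, averaged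
over j ≤ J:
   LRO drops to O(log J/J + J/L) while energy density moves by O(J²/L² + J/L)). Hence the Q/R
(eigenstate) terms are
   indispensable — this is why the interface carries them.
4. Locality no-go (¬ side of 2, worth staffing): for every r, k there is NO GSCertificate at any (U,
δ) — would show
   d-wave LRO is not a finite-range consequence of local GS constraints in this model (Goldstone
softness suggests the
   needed k-uniform infrared family is not finitely generated without RP). Informal.

## Kill criteria
- Crux 4 proved for all (r,k) → close.  - SDP searches at r ≤ 4 return a = 0 to certified precision
on both the
  original and Shiba-dual side for a (U,δ) grid → close (record grid in STATUS).
- Crux 3 refuted → the interface is mis-specified; re-posit.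

## Deliberately NOT decomposed yet
The precise *-algebraic bookkeeping of "translation-averaged, range r, degree k" (left to the
definition item), the
rounding/verification pipeline, and any link to WeakCouplingBCS (weak coupling has a ~ e^{-C/U²}:
certificates must
target |U| ≳ 4).

Rationale: widen: noncommutative SOS / SDP ground-state certificates (WangEtAl2024, FawziFawziScalet2024);
posits interface GSCertificate + construction item; provable obstruction lemma for energy-only
certificates

History (route lifecycle, newest last):
- 2026-08-15T12:56:20Z · CLOSED superseded — superseded:route-HubbardSuperconductivity-FunctionFieldCertificate (planner-HubbardSuperconductivity-route-HubbardSuperconductiv)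

sub-problem: HubbardSuperconductivity · status: closed(superseded) · opened planner-HubbardSuperconductivity-Survey-0 2026-08-13T06:04:33Z · rev 0 · ledger route-HubbardSuperconductivity-GSCertificate
GENERATED by the gate from the ledger (D-0016/17). Provers cite these decls: `theorem foo : Summit.HubbardSuperconductivity.HubbardSuperconductivity.Theses.GSCertificate.<Decl> := …` in Summits/HubbardSuperconductivity/HubbardSuperconductivity/Theorems/<Name>.lean.
-/

namespace Summit.HubbardSuperconductivity.HubbardSuperconductivity.Theses.GSCertificate

open scoped BigOperators Topology Manifold Classical MeasureTheory ProbabilityTheory Matrix InnerProductSpace ComplexConjugate ContinuousMap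
open Filter Set Function TopologicalSpace MeasureTheory

attribute [summit_statement] _root_.HubbardSuperconductivity

open Literature.Hubbard

-- item stmt-HubbardSuperconductivity-0180 · crux · rank 0 · closed · moot by None · by planner — informal only, no Lean statement yet:
--   X := ∃ U ≠ 0, δ ∈ (0,1), r k : ℕ, a > 0, Nonempty (GSCertificate U δ r k a), where a GSCertificate
--   is L-independent data (translation-averaged CAR polynomials of range ≤ r, degree ≤ k: SOS terms O_j;
--   sector-preserving Q_m; Hermitian R; sector-ideal terms T) such that for all L ≥ L₀ the operator
--   identity L⁻⁴ (pairField d L)ᴴ(pairField d L) − a·1 = Σ_j O_jᴴO_j + Σ_m Q_mᴴ[H_L, Q_m] + i[H_L, R] +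
--   T holds on Fock((ℤ/Lℤ)²), H_L = hubbardTorus 2 L 1 U, T ∈ ideal(totalNumber − N_L, spinZ). Lean
--   signature awaits the definition item. || needs_definition: Literature.Hubbard.GSCertificate (def
--   request fil

-- item stmt-HubbardSuperconductivity-0176 · crux · rank 2 · closed · moot by None · by planner — informal only, no Lean statement yet:
--   Search: minimise a subject to the identity as an SDP over translation-invariant pseudo-states
--   (moment matrices of degree k, range r) with the ground-state constraints ω(QᴴQ) ≥ 0, ω(Qᴴ[H,Q]) ≥ 0,
--   ω([H,R]) = 0, sector constraints — the hierarchy of Wang et al. 2024 / Fawzi–Fawzi–Scalet 2024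
--   adapted to fermions and to an LRO objective (needs a k-uniform family in momentum space, cf. the KLS
--   certificate: infrared bound at every k ≠ 0 + sum rule). Also run on the Shiba-dual side (route
--   ShibaRP). Target |U| ≳ 4 (weak coupling has a ~ e^{−C/U²}). Deliverable: explicit rational
--   certificate checked in

/-- item stmt-HubbardSuperconductivity-0177 · support · rank 3 · closed · moot by None · by planner
Proof sketch: take a sector GS ψ_L (a momentum eigenstate is not even needed), twist by the diagonal
unitary U_j = exp(i Σ_x (2πj x₁/L) n_x), j = 1..J (preserves szSector). Energy: on-site term
invariant; hopping picks up phases e^{±2πij/L} on x-bonds, so |Δe| ≤ (1−cos(2πj/L))·8 +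
sin(2πj/L)·‖J_x‖/L² = O(J²/L² + J/L). LRO: pairs carry charge 2, so L⁻⁴⟨Δ_d†Δ_d⟩_{twisted} = L⁻⁴ Re
Σ_{x,y} e^{4πij(y₁−x₁)/L} G(x,y) + O(J/L) with |G| ≤ 8; averaging over j ≤ J with the
Fejér/Dirichlet kernel gives ≤ C log J / J + O(J/L). Plug into the hypothesis, let L → ∞ then J → ∞.
Consequence: certificates MUST use eigenstate constraints (the Q, R terms of GSCertificate) —
calibrates the interface. Note Filter.liminf needs the (true) boundedness |e_GS(L)| ≤ 8 + |U|. ||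
Sources: PitaevskiiStringari1991, KomaTasaki1994. || UNELABORATED: `lean check` impossible on
2026-08-13 ~06:00Z (build artefact
Literature/MathematicalPhysics/QuantumLattice/FermionOperators.olean missing; planner may not run
lake build). Written in the exact syntax of Summits/HubbardSuperconductivity/Statement.lean with
fully qualified names; refuter please elaborate. -/
@[route_item "route-HubbardSuperconductivity-GSCertificate"]
def GscertEnergyOnlyObstruction : Prop :=
  ∀ (U δ a b e₀ : ℝ), 0 < a → 0 ≤ b → δ ∈ Set.Ioo (0:ℝ) 1 → (∀ (L : ℕ) [NeZero L] (ψ : Literature.MathematicalPhysics.QuantumLattice.Fock (Literature.MathematicalPhysics.QuantumLattice.Orb (Literature.MathematicalPhysics.QuantumLattice.FermionTorus 2 L))), ψ ∈ Literature.MathematicalPhysics.QuantumLattice.szSector (2 * ⌊(1 - δ) * (L : ℝ) ^ 2 / 2⌋₊) 0 → star ψ ⬝ᵥ ψ = 1 → a - b * ((star ψ ⬝ᵥ Matrix.mulVec (Literature.MathematicalPhysics.QuantumLattice.hubbardTorus 2 L 1 U) ψ).re / (L : ℝ) ^ 2 - e₀) ≤ (star ψ ⬝ᵥ Matrix.mulVec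 (Matrix.conjTranspose (Literature.MathematicalPhysics.QuantumLattice.pairField Literature.MathematicalPhysics.QuantumLattice.dWaveFormFactor L) * Literature.MathematicalPhysics.QuantumLattice.pairField Literature.MathematicalPhysics.QuantumLattice.dWaveFormFactor L) ψ).re / (L : ℝ) ^ 4) → a ≤ b * (Filter.liminf (fun L : ℕ => (Literature.MathematicalPhysics.QuantumLattice.hubbardTorus 2 (L + 1) 1 U).minEnergyOn (Literature.MathematicalPhysics.QuantumLattice.szSector (2 * ⌊(1 - δ) * ((L + 1 : ℕ) : ℝ) ^ 2 / 2⌋₊) 0) / ((L + 1 : ℕ) : ℝ) ^ 2) Filter.atTop - e₀)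

/-- item stmt-HubbardSuperconductivity-0407 · support · rank 3 · closed · moot by None · by planner
SUPERSEDES stmt-HubbardSuperconductivity-0177 (same mathematics; 0177's signature writes the adjoint
with the SCOPED postfix notation ᴴ, which fails to PARSE unless `open Matrix`/`open scoped Matrix`
is in effect at the probe site — the gate appends `example : Prop := (sig)` after `end <ns>`, where
it is not; this item spells it `Matrix.conjTranspose (…)`. Grounder/refuter: please mark 0177
illtyped/duplicate of this item.) ELABORATED 2026-08-13 06:27Z by planner: `example : (sig) := by
sorry` rc=0 with NO `open`s, against Summits.HubbardSuperconductivity.Statement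
(FermionOperators.olean rebuilt locally from the working-tree source with its one broken proof at
:87 replaced by sorry — signature typing unaffected). || Proof sketch: take a sector GS ψ_L (a
momentum eigenstate is not even needed), twist by the diagonal unitary U_j = exp(i Σ_x (2πj x₁/L)
n_x), j = 1..J (preserves szSector). Energy: on-site term invariant; hopping picks up phases
e^{±2πij/L} on x-bonds, so |Δe| ≤ (1−cos(2πj/L))·8 + sin(2πj/L)·‖J_x‖/L² = O(J²/L² + J/L). LRO:
pairs carry charge 2, so L⁻⁴⟨Δ_d†Δ_d⟩_{twisted} = L⁻⁴ Re Σ_{x,y} e^{4πij(y₁−x₁)/L} G(x,y) + O(J/L)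
with |G| ≤ 8; averaging over j ≤ J with the Fejér -/
@[route_item "route-HubbardSuperconductivity-GSCertificate"]
def GscertEnergyOnlyObstructionV2 : Prop :=
  ∀ (U δ a b e₀ : ℝ), 0 < a → 0 ≤ b → δ ∈ Set.Ioo (0:ℝ) 1 → (∀ (L : ℕ) [NeZero L] (ψ : Literature.MathematicalPhysics.QuantumLattice.Fock (Literature.MathematicalPhysics.QuantumLattice.Orb (Literature.MathematicalPhysics.QuantumLattice.FermionTorus 2 L))), ψ ∈ Literature.MathematicalPhysics.QuantumLattice.szSector (2 * ⌊(1 - δ) * (L : ℝ) ^ 2 / 2⌋₊) 0 → star ψ ⬝ᵥ ψ = 1 → a - b * ((star ψ ⬝ᵥ Matrix.mulVec (Literature.MathematicalPhysics.QuantumLattice.hubbardTorus 2 L 1 U) ψ).re / (L : ℝ) ^ 2 - e₀) ≤ (star ψ ⬝ᵥ Matrix.mulVec (Matrix.conjTranspose (Literature.MathematicalPhysics.QuantumLattice.pairField Literature.MathematicalPhysics.QuantumLattice.dWaveFormFactor L) * Literature.MathematicalPhysics.QuantumLattice.pairField Literature.MathematicalPhysics.QuantumLattice.dWaveFormFactor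 L) ψ).re / (L : ℝ) ^ 4) → a ≤ b * (Filter.liminf (fun L : ℕ => (Literature.MathematicalPhysics.QuantumLattice.hubbardTorus 2 (L + 1) 1 U).minEnergyOn (Literature.MathematicalPhysics.QuantumLattice.szSector (2 * ⌊(1 - δ) * ((L + 1 : ℕ) : ℝ) ^ 2 / 2⌋₊) 0) / ((L + 1 : ℕ) : ℝ) ^ 2) Filter.atTop - e₀)

-- item stmt-HubbardSuperconductivity-0178 · support · rank 4 · closed · moot by None · by planner — informal only, no Lean statement yet:
--   ∀ U δ r k a, 0 < a → IsEmpty (GSCertificate U δ r k a). Heuristic for: Goldstone softness — KLS-type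
--   certificates need an infrared bound at EVERY k ≠ 0, i.e. an infinite k-family, which without
--   reflection positivity is not expected to be generated by finitely many local Q-terms. Heuristic
--   against: translation-averaged certificates ARE k-uniform families. Either answer is publishable; a
--   proof closes the route. || needs_definition: Literature.Hubbard.GSCertificate. || Sources:
--   WangEtAl2024, KLS1988PRL, PitaevskiiStringari1991.

/-- item stmt-HubbardSuperconductivity-0181 · assembly · rank 1 · closed · moot by None · by planner
For a sector GS ψ (HYP): ⟨O_jᴴO_j⟩ ≥ 0; ⟨Q_mᴴ[H,Q_m]⟩ = ⟨Q_mψ,(H − E_min)Q_mψ⟩ ≥ 0 because Q_m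
preserves szSector N_L 0 and E_min = minEnergyOn; ⟨i[H,R]⟩ = 0 (eigenvector); ⟨T⟩ = 0 (sector).
Hence L⁻⁴Re⟨Δ_d†Δ_d⟩ ≥ a for all L ≥ L₀ (odd L included) ⇒ HasTorusLRO via hasTorusLRO_iff /
hasPairFieldLRO_iff_liminf; norm/IsNParticle from WeakCouplingBCS #5. || needs_definition:
Literature.Hubbard.GSCertificate. || Sources: WangEtAl2024. -/
@[route_item "route-HubbardSuperconductivity-GSCertificate"]
def Assembly : Prop :=
  ∀ (U δ a : ℝ), 0 < U → δ ∈ Set.Ioo (0:ℝ) (1 / 2) → 0 < a → (∃ L₀ : ℕ, ∀ (L : ℕ) [NeZero L], L₀ ≤ L → ∃ (n m : ℕ) (O : Fin n → Matrix (Finset (Literature.MathematicalPhysics.QuantumLattice.Orb (Literature.MathematicalPhysics.QuantumLattice.FermionTorus 2 L))) (Finset (Literature.MathematicalPhysics.QuantumLattice.Orb (Literature.MathematicalPhysics.QuantumLattice.FermionTorus 2 L))) ℂ) (Q : Fin m → Matrix (Finset (Literature.MathematicalPhysics.QuantumLattice.Orb (Literature.MathematicalPhysics.QuantumLattice.FermionTorus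 2 L))) (Finset (Literature.MathematicalPhysics.QuantumLattice.Orb (Literature.MathematicalPhysics.QuantumLattice.FermionTorus 2 L))) ℂ) (R T : Matrix (Finset (Literature.MathematicalPhysics.QuantumLattice.Orb (Literature.MathematicalPhysics.QuantumLattice.FermionTorus 2 L))) (Finset (Literature.MathematicalPhysics.QuantumLattice.Orb (Literature.MathematicalPhysics.QuantumLattice.FermionTorus 2 L))) ℂ), (∀ (i : Fin m) (ψ : Literature.MathematicalPhysics.QuantumLattice.Fock (Literature.MathematicalPhysics.QuantumLattice.Orb (Literature.MathematicalPhysics.QuantumLattice.FermionTorus 2 L))), ψ ∈ Literature.MathematicalPhysics.QuantumLattice.szSector (2 * ⌊(1 - δ) * (L : ℝ) ^ 2 / 2⌋₊) 0 → Matrix.mulVec (Q i) ψ ∈ Literature.MathematicalPhysics.QuantumLattice.szSector (2 * ⌊(1 - δ) * (L : ℝ) ^ 2 / 2⌋₊) 0) ∧ (∀ (ψ : Literature.MathematicalPhysics.QuantumLattice.Fock (Literature.MathematicalPhysics.QuantumLattice.Orb (Literature.MathematicalPhysics.QuantumLattice.FermionTorus 2 L))), ψ ∈ Literature.MathematicalPhysics.QuantumLattice.szSector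 (2 * ⌊(1 - δ) * (L : ℝ) ^ 2 / 2⌋₊) 0 → star ψ ⬝ᵥ Matrix.mulVec T ψ = 0) ∧ (1 / (L : ℂ) ^ 4) • (Matrix.conjTranspose (Literature.MathematicalPhysics.QuantumLattice.pairField Literature.MathematicalPhysics.QuantumLattice.dWaveFormFactor L) * Literature.MathematicalPhysics.QuantumLattice.pairField Literature.MathematicalPhysics.QuantumLattice.dWaveFormFactor L) - (a : ℂ) • (1 : Matrix (Finset (Literature.MathematicalPhysics.QuantumLattice.Orb (Literature.MathematicalPhysics.QuantumLattice.FermionTorus 2 L))) (Finset (Literature.MathematicalPhysics.QuantumLattice.Orb (Literature.MathematicalPhysics.QuantumLattice.FermionTorus 2 L))) ℂ) = ∑ i : Fin n, Matrix.conjTranspose (O i) * O i + ∑ i : Fin m, Matrix.conjTranspose (Q i) * (Literature.MathematicalPhysics.QuantumLattice.hubbardTorus 2 L 1 U * Q i - Q i * Literature.MathematicalPhysics.QuantumLattice.hubbardTorus 2 L 1 U) + Complex.I • (Literature.MathematicalPhysics.QuantumLattice.hubbardTorus 2 L 1 U * R - R * Literature.MathematicalPhysics.QuantumLattice.hubbardTorus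 2 L 1 U) + T) → HubbardSuperconductivity

end Summit.HubbardSuperconductivity.HubbardSuperconductivity.Theses.GSCertificate
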